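import Summits.QuantumFields.YangMills.Theorems.LuscherReductionTwistedTraceScalingBOStiffJumpFloor
import HarnessLib

/-!
# (B-ST) ★★★ `spec_gap_inputs` MODULO THE FLAT POINCARÉ INEQUALITY: the door data of the fibre block are `D := cD`, `J₀ := cJ0`, `Cν = C'ν = 2`, `cJ = 1/6`
# (lane A of S-BASE, crux `TwistedTraceScaling` stmt-QuantumFields-20203, C4-CORE, the (B-ST) pen; `pub/ym-fleet/ym-luscher-20007-p1/HANDOFF-g22.md` §DESIGN, spec `g21-FibreBlock-spec.lean`)

★★★ `spec_gap_inputs_of_hflat` — for `L` with a non-zero site and `1/6 < s < 1/4`, the statement `spec_gap_inputs` of the (L-3) spec (VERBATIM the hypothesis `hGI` of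
✓`…BOStiffCore.hcore_record_of_specs` / ✓`…BOStiffHST.hST_record_of_specs`) FOLLOWS from ONE flat Poincaré hypothesis for the explicit pair `(cD, cJ0)` of ✓`…BOStiffFlatDefs`:
  `hflat : ∃ M₁, ∀ M ≥ M₁, ∃ P₀ > 0, ∀ δ > 0, ∀ᶠ β, ∀ g` (measurable, bounded, vanishing off `cS L β`),
    `∫_{cS} g²·cD − (∫_{cS} g·cD)²/∫_{cS} cD ≤ P₀·½∫∫(g x − g y)²·cJ0 L s M β x y dπ dπ + δ·∫_{cS} g²·cD`
— the Poincaré inequality of the `cD`-reversible model chain `cJ0 = cΘ⊗cΘ·cK·cZ/cIk` (Mehler ⊗ gauge resampling; hand w3 + PiDensity).  The other clauses are in the tree: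
`hν/hν'` ✓`central_density_compare` (ε = 1), `hJ` ✓`hJ_record` (`cJ = 1/6`), floor ✓`cΘ_floor`, data ✓`cD_data`/`measurable_cJ0`/`abs_cJ0_le`, and ★ `setIntegral_cD_pos`
(`0 < ∫_{cS} cD`, from the explicit floor of `cD` on `cS` and `0 < π(cS)` ⇐ `0 < ∫cΘ dπ`).  `P₀` is enlarged to `max P₀ 1` so that `cJ/(Cν P₀) ≤ 1`.
So, with ✓`recordAnalyticInput_of_specs`, the (B-ST) pen and C4-CORE's `RecordAnalyticInput` (1/6 < s < 1/4) are now CONDITIONAL on exactly two named analytic statements: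
(A) `spec_S3` (hand w1) and this `hflat`.
HONEST FRAMING: assembly for a stub of a child of the CONDITIONAL route R2b1; (A) and `hflat` OPEN; (B-ST) OPEN; C4-CORE OPEN; not infinite volume, not a gap, not Clay.
-/

set_option autoImplicit false

noncomputable section

open MeasureTheory Filter Topology Real
open scoped BigOperators
open Literature.MathematicalPhysics.QuantumFieldTheory
open Literature.MathematicalPhysics.QuantumLattice

namespace Summit.QuantumFields.YangMills.Theorems.FemtoTransferGap.TwoLattice.ConstTube

open Summit.QuantumFields.YangMills.Theorems.FemtoTransferGap
open Summit.QuantumFields.YangMills.Theorems.FemtoTransferGap.TwoLattice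
open Summit.QuantumFields.YangMills.Theorems.FemtoTransferGap.TwoLattice.Avg
open Summit.QuantumFields.YangMills.Theorems.FemtoTransferGap.TwoLattice.Stiff
open Summit.QuantumFields.YangMills.Theorems.FemtoTransferGap.TwoLattice.GnChart
open Summit.QuantumFields.YangMills.Theorems.FemtoTransferGap.TwoLattice.Cov (scalarPart_inv vecPart_inv)

variable {L : ℕ} [NeZero L]

/-! ## §1 Positivity of the model density on the support -/

/-- `0 < π(cS)` (indeed `∫cΘ dπ ≤ π(cS)` and `0 < ∫cΘ dπ`). [folklore] -/
theorem measureReal_cS_pos (β : ℝ) : 0 < (orthoTransverse L).real (cS L β) := by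
  haveI := isFiniteMeasure_orthoTransverse L
  obtain ⟨hΘm, hΘ1, hΘ0⟩ := cΘ_data (L := L) β
  have h := integral_cΘ_pos (L := L) β
  have hle : ∫ x, cΘ L β x ∂orthoTransverse L ≤ ∫ x, (cS L β).indicator (fun _ => (1 : ℝ)) x ∂orthoTransverse L := by
    refine integral_mono_of_nonneg (ae_of_all _ hΘ0) ((integrable_const (1 : ℝ)).indicator (measurableSet_cS (L := L) β)) (ae_of_all _ fun x => ?_)
    by_cases hx : x ∈ cS L β
    · rw [Set.indicator_of_mem hx]; exact (le_abs_self _).trans (hΘ1 x)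
    · rw [Set.indicator_of_notMem hx, cΘ_eq_zero_of_not_mem_cS β x hx]
  rw [integral_indicator_const _ (measurableSet_cS (L := L) β), smul_eq_mul, mul_one] at hle
  exact lt_of_lt_of_le h hle

/-- ★ `0 < ∫_{cS} cD dπ` (`β ≥ 0`): on `cS`, `cD ≥ N̄(β⁻¹)·e^{−r²/β^{-2} − 2(96(β/2)+β)r²} > 0` and `π(cS) > 0`. [folklore] -/
theorem setIntegral_cD_pos {β : ℝ} (hβ : 0 ≤ β) : 0 < ∫ x in cS L β, cD L β x ∂orthoTransverse L := by
  haveI := isFiniteMeasure_orthoTransverse L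
  set r := min (1 / 40) (powScale (1 / 2) β * btLog β) with hr
  set m := fpWeightBar L (powScale 1 β) * (Real.exp (-(r ^ 2 / powScale 1 β ^ 2)) * Real.exp (-(2 * ((96 * (β / 2) + β) * r ^ 2)))) with hm
  have hm0 : 0 < m := mul_pos (fpWeightBar_pos L (powScale_pos 1 β)) (mul_pos (Real.exp_pos _) (Real.exp_pos _))
  obtain ⟨hDm, hD0, hDb⟩ := cD_data (L := L) β
  have hfloor : ∀ x ∈ cS L β, m ≤ cD L β x := by
    intro x hx
    obtain ⟨-, hxr⟩ := cΘ_eq_on_cS (L := L) β hx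
    change ‖linkEmbed L x‖ ≤ r at hxr
    have hP : ‖(gaugeModes L).starProjection (linkEmbed L x)‖ ≤ r := (Submodule.norm_starProjection_apply_le _ _).trans hxr
    have hP2 : ‖(gaugeModes L).starProjection (linkEmbed L x)‖ ^ 2 ≤ r ^ 2 := pow_le_pow_left₀ (norm_nonneg _) hP 2
    have hq : stiffGaussExp L (β / 2) β (linkEmbed L x) ≤ (96 * (β / 2) + β) * r ^ 2 :=
      (stiffGaussExp_le_mul_norm_sq (L := L) (by linarith) hβ _).trans (mul_le_mul_of_nonneg_left (pow_le_pow_left₀ (norm_nonneg _) hxr 2) (by linarith))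
    have hps : 0 < powScale 1 β ^ 2 := pow_pos (powScale_pos _ _) 2
    unfold cD
    refine mul_le_mul_of_nonneg_left ?_ (fpWeightBar_pos L (powScale_pos 1 β)).le
    refine mul_le_mul ?_ ?_ (Real.exp_pos _).le (Real.exp_pos _).le
    · exact Real.exp_le_exp.2 (neg_le_neg (div_le_div_of_nonneg_right hP2 hps.le))
    · exact Real.exp_le_exp.2 (neg_le_neg (by linarith))
  have hle : ∫ x in cS L β, m ∂orthoTransverse L ≤ ∫ x in cS L β, cD L β x ∂orthoTransverse L :=
    setIntegral_mono_on (integrable_const m).integrableOn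
      ((integrable_of_measurable_abs_le (orthoTransverse L) hDm (C := fpWeightBar L (powScale 1 β)) hDb).integrableOn) (measurableSet_cS (L := L) β) hfloor
  rw [setIntegral_const, smul_eq_mul] at hle
  exact lt_of_lt_of_le (mul_pos (measureReal_cS_pos (L := L) β) hm0) hle

/-! ## §2 ★★★ `spec_gap_inputs` from the flat Poincaré inequality -/

set_option maxHeartbeats 1600000 in
-- large record expressions.
/-- ★★★ **`spec_gap_inputs` MODULO `hflat`** (see the module docstring). [cite: Luscher1983, §3] [cite: SjostrandZworski2007, §2] -/
theorem spec_gap_inputs_of_hflat (hLz : Nonempty (NzSite L)) (_hL2 : 2 ≤ L) {s : ℝ} (hs6 : 1 / 6 < s) (hs4 : s < 1 / 4)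
    (hflat : ∃ M₁ : ℝ, ∀ M : ℝ, M₁ ≤ M → ∃ P₀ : ℝ, 0 < P₀ ∧ ∀ δ : ℝ, 0 < δ → ∀ᶠ β : ℝ in atTop,
      ∀ g : (Edge 3 L → Fin 3 → ℝ) → ℝ, Measurable g → (∃ C : ℝ, ∀ x, |g x| ≤ C) → (∀ x, x ∉ cS L β → g x = 0) →
        (∫ x in cS L β, g x ^ 2 * cD L β x ∂orthoTransverse L) - (∫ x in cS L β, g x * cD L β x ∂orthoTransverse L) ^ 2 / (∫ x in cS L β, cD L β x ∂orthoTransverse L) ≤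
          P₀ * ((1 / 2) * ∫ x, ∫ y, (g x - g y) ^ 2 * cJ0 L s M β x y ∂orthoTransverse L ∂orthoTransverse L) + δ * ∫ x in cS L β, g x ^ 2 * cD L β x ∂orthoTransverse L) :
    ∃ M₀ : ℝ, 2 ≤ M₀ ∧ ∀ M : ℝ, M₀ ≤ M → ∃ P₀ Cν C'ν cJ : ℝ, 0 < P₀ ∧ 0 < Cν ∧ 0 < C'ν ∧ 0 < cJ ∧ cJ / (Cν * P₀) ≤ 1 ∧
      ∀ δ : ℝ, 0 < δ → ∀ᶠ β : ℝ in atTop, ∃ (D : (Edge 3 L → Fin 3 → ℝ) → ℝ) (J₀ : (Edge 3 L → Fin 3 → ℝ) → (Edge 3 L → Fin 3 → ℝ) → ℝ) (θ₀ CD CJ : ℝ),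
        Measurable D ∧ (∀ x, |D x| ≤ CD) ∧ Measurable (Function.uncurry J₀) ∧ (∀ x y, |J₀ x y| ≤ CJ) ∧ 0 < θ₀ ∧ (∀ x ∈ cS L β, θ₀ ≤ cΘ L β x) ∧
        0 < ∫ x in cS L β, D x ∂orthoTransverse L ∧
        (∀ x ∈ cS L β, cΘ L β x ^ 2 * cW L s M β x ≤ Cν * D x) ∧ (∀ x ∈ cS L β, D x ≤ C'ν * (cΘ L β x ^ 2 * cW L s M β x)) ∧
        (∀ x y, cJ * (cΛ L s M β * J₀ x y) ≤ cΘ L β x * cM L β x y * cΘ L β y) ∧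
        (∀ g : (Edge 3 L → Fin 3 → ℝ) → ℝ, Measurable g → (∃ C : ℝ, ∀ x, |g x| ≤ C) → (∀ x, x ∉ cS L β → g x = 0) →
          (∫ x in cS L β, g x ^ 2 * D x ∂orthoTransverse L) - (∫ x in cS L β, g x * D x ∂orthoTransverse L) ^ 2 / (∫ x in cS L β, D x ∂orthoTransverse L) ≤
            P₀ * ((1 / 2) * ∫ x, ∫ y, (g x - g y) ^ 2 * J₀ x y ∂orthoTransverse L ∂orthoTransverse L) + δ * ∫ x in cS L β, g x ^ 2 * D x ∂orthoTransverse L) := by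
  have hs : 0 < s := by linarith
  have hs3 : s ≤ 1 / 3 := by linarith
  obtain ⟨M₀d, hM₀d, Hd⟩ := central_density_compare (L := L) hLz hs hs3
  obtain ⟨M₁, Hf⟩ := hflat
  refine ⟨max (max M₀d M₁) 2, le_max_right _ _, fun M hM => ?_⟩
  have hMd : M₀d ≤ M := le_trans (le_max_left _ _) (le_trans (le_max_left _ _) hM)
  have hM1 : M₁ ≤ M := le_trans (le_max_right _ _) (le_trans (le_max_left _ _) hM)
  obtain ⟨P₀, hP₀, HP⟩ := Hf M hM1
  set P := max P₀ 1 with hP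
  have hP1 : 1 ≤ P := le_max_right _ _
  have hPP : P₀ ≤ P := le_max_left _ _
  refine ⟨P, 2, 2, 1 / 6, by positivity, by norm_num, by norm_num, by norm_num, ?_, fun δ hδ => ?_⟩
  · rw [div_le_one (by positivity)]; linarith
  filter_upwards [Hd M hMd 1 one_pos, HP δ hδ, hJ_record (L := L) hLz, eventually_ge_atTop (0 : ℝ)] with β hd hf hJ hβ
  obtain ⟨hDm, hD0, hDb⟩ := cD_data (L := L) β
  refine ⟨cD L β, cJ0 L s M β,
    Real.exp (-((min (1 / 40) (powScale (1 / 2) β * btLog β)) ^ 2 / powScale 1 β ^ 2 + (96 * (β / 2) + β) * (min (1 / 40) (powScale (1 / 2) β * btLog β)) ^ 2)),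
    fpWeightBar L (powScale 1 β), cZ L s M β / cIk L β, hDm, hDb, measurable_cJ0 (L := L) s M β, abs_cJ0_le (L := L) hβ s M, Real.exp_pos _,
    fun x hx => cΘ_floor (L := L) hβ hx, setIntegral_cD_pos (L := L) hβ, fun x hx => ?_, fun x hx => ?_, fun x y => hJ s M x y, fun g hg hgb hgS => ?_⟩
  · have h := (hd x hx).1
    change cΘ L β x ^ 2 * cW L s M β x ≤ (1 + 1) * cD L β x at h
    linarith
  · have h := (hd x hx).2
    change cD L β x ≤ (1 + 1) * (cΘ L β x ^ 2 * cW L s M β x) at h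
    linarith
  · have h := hf g hg hgb hgS
    have hE : 0 ≤ (1 / 2) * ∫ x, ∫ y, (g x - g y) ^ 2 * cJ0 L s M β x y ∂orthoTransverse L ∂orthoTransverse L := by
      refine mul_nonneg (by norm_num) (integral_nonneg fun x => integral_nonneg fun y => mul_nonneg (sq_nonneg _) ?_)
      obtain ⟨-, -, hΘ0⟩ := cΘ_data (L := L) β
      unfold cJ0
      exact mul_nonneg (mul_nonneg (mul_nonneg (hΘ0 x) (cK_pos_le_one (L := L) hβ x y).1.le) (hΘ0 y))
        (div_nonneg (cZ_nonneg (L := L) s M β) (cIk_pos (L := L) hβ).le)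
    have := mul_le_mul_of_nonneg_right hPP hE
    linarith

end Summit.QuantumFields.YangMills.Theorems.FemtoTransferGap.TwoLattice.ConstTube

end
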